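import Summits.ValiantsHypothesis.ValiantsHypothesis.Theorems.TwistedDetRankSliceVBPFermionicReturnGadget
import Summits.ValiantsHypothesis.ValiantsHypothesis.Theorems.FermionicJetHcProjectsToCdetCycles
import Literature.Computability.AlgebraicComplexity.FermionantCompletenessProofs
import Literature.Computability.AlgebraicComplexity.FermionicPencil

/-!
# Crux `TwistedDetRank.SliceVBPFermionic` (stmt-ValiantsHypothesis-17991, X2b) — the fermionic
# pencil `sgn·t^{c}` and the even-cycle family `G_n` are `VNP ⊄ VBP`-hard (kernel census rows)

Fourth file of the return-gadget series for X2b.  Two more rows of the falsifier census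
(Cruxes/SliceVBPFermionic/CALIBRATION.md) become theorems, using the tree's proof of
de Rugy-Altherre's Theorem 1 (Literature/…/FermionantCompletenessProofs.lean: `per_n = κ⁻¹ • φsub(Ferm^t_{N(n)})`,
a projection, `N(n) = O(n⁴)`, rational `t ∉ {0,1}`):

* §1 `hasDetRepr_perPoly_of_fermionicPencil`, `not_dcPerSuperpolynomial_of_fermionicPencil_hasDetRepr`
  — de Rugy-Altherre's reduction in `dc` currency: the FERMIONIC PENCIL family
  `Ferm^t_n = Σ_σ sgn σ · t^{c(σ)} X^σ` (the GMF of the class function `sgn·t^{c}`, `c` = number of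
  cycles with fixed points; `fermionicPencil_eq_gmf`) has p-bounded `dc` only if the permanent does.
  This covers the fermionants `Ferm_k`, `k ≥ 2` (Mertens–Moore) and every rational cycle-count
  twist: none of them can refute X2b unless `VBP = VNP`.
* §2 THE EVEN-CYCLE FAMILY `G_n = Σ_{σ: all cycles even} sgn σ · 2^{c(σ)} X^σ`
  (`evenCycleClass`; `= Σ_S (−1)^{|S|} det X_S det X_{S̄}`, the standing falsifier of the parent crux's
  STRATEGY-CENSUS §Negation, left there as "θ = −1 undecided"): all cycles of a block swap are even
  (`even_of_mem_cycleType_swapPerm`: an odd cycle would give a point fixed by an odd power, but odd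
  powers exchange the two copies) and `c(σ_{1,ρ}) = c(ρ)` (`numCycles_swapPerm_one`, the tree's
  `numCycles_retPerm`), so the `(0 Y; 1 0)`-gadget DOUBLES `G_{2a}` to `ε · Ferm²_a`
  (`aeval_retSubstFin_one_evenCycle`), `dc(Ferm²_a) ≤ dc(G_{2a}) + 1`, and with §1 at `t = 2`:
  `not_dcPerSuperpolynomial_of_evenCycle_hasDetRepr` — `G` lies in the VBP slice only if `VBP = VNP`;
  `evenCycle_not_hasDetRepr_of_dcPerSuperpolynomial` — under Valiant's determinantal hypothesis it
  cannot witness `¬ SliceVBPFermionic`.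

HONEST FRAMING.  Census work on the refutation side; X2b itself (≥ `VNP ⊄ VBP`) is neither proved
nor refuted; `VP ≠ VNP` is not moved by this item.

References: N. de Rugy-Altherre, CiE 2013, LNCS 7921, 87–96 (arXiv:1309.2156) Thm 1; S. Mertens,
C. Moore, Theory of Computing 9 (2013), Thms 1–2; P. Bürgisser 2000 §2.5.  The `def` `evenCycleClass`
is a proof gadget naming the family, not a route object.
-/

-- single-conjunct layout: Sub = Summit, duplicated namespace component intended
set_option linter.dupNamespace false

noncomputable section

namespace Summit.ValiantsHypothesis.ValiantsHypothesis.Theorems.TwistedDetRankSliceVBPFermionic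

open Equiv MvPolynomial Literature.Computability.AlgebraicComplexity
open Summit.ValiantsHypothesis.ValiantsHypothesis.Theorems.TwistedDetRankFermionicNormalForm
open scoped BigOperators

/-! ## §1 The fermionic pencil `sgn · t^{c(σ)}` (rational `t ∉ {0,1}`) is `VNP ⊄ VBP`-hard, in `dc` currency -/

section Pencil

open Literature.Computability.AlgebraicComplexity.DeRugyAltherre

/-- **de Rugy-Altherre's reduction in `dc` currency.** For rational `t ∉ {0, 1}` and `n ≥ 1`,
`dc(per_n) ≤ dc(Ferm^t_{N(n)}) + 1`: the permanent is the non-zero scalar multiple `κ⁻¹` of the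
projection `φsub` of the fermionic pencil `Ferm^t_{N(n)} = Σ_σ sgn σ · t^{c(σ)} X^σ`
(tree: `perPoly_eq_smul_aeval`, Literature/…/FermionantCompletenessProofs.lean), projections keep
affine determinantal representations (`HasDetRepr.of_isProjection_holds`) and a scalar costs one
row. [cite: DeRugyAltherre2013, Thm. 1 (§3)] -/
theorem hasDetRepr_perPoly_of_fermionicPencil (t : ℚ) (ht0 : t ≠ 0) (ht1 : t ≠ 1) {n m : ℕ}
    [NeZero n] (h : HasDetRepr (fermionicPencil (Fin (Nsize n)) ℂ (t : ℂ)) m) :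
    HasDetRepr (perPoly (Fin n) ℂ) (m + 1) := by
  have hp : HasDetRepr (MvPolynomial.aeval (φsub ℂ n t) (fermionicPencil (Fin (Nsize n)) ℂ (t : ℂ))) m :=
    HasDetRepr.of_isProjection_holds h ⟨φsub ℂ n t, fun pq => φsub_VOC ℂ n t pq, rfl⟩
  rw [perPoly_eq_smul_aeval ℂ n t ht0 ht1, MvPolynomial.smul_eq_C_mul]
  exact hasDetRepr_C_mul (HasDetRepr.mono_holds hp (Nat.le_succ m)) _

/-- The fermionic pencil IS the GMF of the class function `σ ↦ sgn σ · t^{c(σ)}` (`c` = number of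
cycles counting fixed points, tree `Equiv.Perm.numCycles`). [folklore] -/
theorem fermionicPencil_eq_gmf (t : ℂ) (n : ℕ) :
    fermionicPencil (Fin n) ℂ t = ∑ σ : Perm (Fin n),
      C (((Perm.sign σ : ℤ) : ℂ) * t ^ σ.numCycles) *
        ∏ i, (X (σ i, i) : MvPolynomial (Fin n × Fin n) ℂ) := rfl

/-- **The fermionic pencil family lies in the VBP slice only if `VBP = VNP`** (rational
`t ∉ {0,1}`; `t = 1` is the determinant): p-bounded `dc(Ferm^t_n)` gives p-bounded `dc(per_n)`
(`N(n)` is p-bounded, `Nsize_isPBounded`).  This is the item's fermionant row of the falsifier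
census in kernel form: the cycle-count twists `sgn·t^{c}` — in particular the fermionants `Ferm_k`,
`k ≥ 2` — cannot refute X2b unless `VBP = VNP`. [cite: DeRugyAltherre2013, Thm. 1 (§3)] -/
theorem not_dcPerSuperpolynomial_of_fermionicPencil_hasDetRepr (t : ℚ) (ht0 : t ≠ 0) (ht1 : t ≠ 1)
    (hdc : ∃ c : ℕ, ∀ n : ℕ, ∃ m ≤ n ^ c + c, HasDetRepr (fermionicPencil (Fin n) ℂ (t : ℂ)) m) :
    ¬ DcPerSuperpolynomial ℂ := by
  intro hsuper
  apply hsuper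
  obtain ⟨c, hc⟩ := hdc
  set K₀ : ℕ := determinantalComplexity (perPoly (Fin 0) ℂ) with hK₀
  have hbound : ∀ n, determinantalComplexity (perPoly (Fin n) ℂ) ≤ K₀ + ((Nsize n) ^ c + c + 1) := by
    intro n
    rcases Nat.eq_zero_or_pos n with rfl | hn
    · omega
    · haveI : NeZero n := ⟨hn.ne'⟩
      obtain ⟨m, hm, hrep⟩ := hc (Nsize n)
      have h1 := determinantalComplexity_le_of_hasDetRepr
        (hasDetRepr_perPoly_of_fermionicPencil t ht0 ht1 hrep)
      omega
  have hpow : IsPBounded (fun n : ℕ => n ^ c + c) := ⟨c, fun n => le_rfl⟩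
  have hpoly := IsPBounded.add_holds hpow (IsPBounded.const 1)
  have hcomp := IsPBounded.comp_holds hpoly Nsize_isPBounded
  have hall := IsPBounded.add_holds (IsPBounded.const K₀) hcomp
  exact IsPBounded.mono hall hbound

end Pencil

/-! ## §2 The strategist's standing falsifier `G_n = Σ_{σ: all cycles even} sgn σ 2^{c(σ)} X^σ`
doubles to the `2`-fermionant, hence is `VNP ⊄ VBP`-hard -/

section EvenCycles

variable {a : ℕ}

/-- Odd powers of a block swap exchange the two copies, so they have no fixed point. [folklore] -/
theorem swapPerm_pow_odd_ne_self (p q : Perm (Fin a)) (k : ℕ) (z : Fin a ⊕ Fin a) :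
    (swapPerm p q ^ (2 * k + 1)) z ≠ z := by
  have hinr : ∀ j (w : Fin a), (swapPerm p q ^ (2 * j)) (Sum.inr w) = Sum.inr (((p * q) ^ j) w) := by
    intro j w
    induction j generalizing w with
    | zero => simp
    | succ j ih =>
      rw [show 2 * (j + 1) = 2 * j + 1 + 1 by ring, pow_succ, pow_succ, Perm.mul_apply,
        Perm.mul_apply, swapPerm_inr, swapPerm_inl, ih, pow_succ, Perm.mul_apply, Perm.mul_apply]
  rcases z with w | w
  · rw [pow_succ', Perm.mul_apply, swapPerm_pow_two_mul_inl, swapPerm_inl]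
    exact Sum.inr_ne_inl
  · rw [pow_succ', Perm.mul_apply, hinr, swapPerm_inr]
    exact Sum.inl_ne_inr

/-- **All cycles of a block swap are even**: a cycle of odd length `l` would give a point fixed by
the `l`-th power. [folklore] -/
theorem even_of_mem_cycleType_swapPerm (p q : Perm (Fin a)) {l : ℕ}
    (hl : l ∈ (swapPerm p q).cycleType) : Even l := by
  by_contra hodd
  rw [Nat.not_even_iff_odd] at hodd
  obtain ⟨k, rfl⟩ := hodd
  obtain ⟨c, τ, hστ, hdisj, hcyc, hcard⟩ := Perm.mem_cycleType_iff.1 hl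
  obtain ⟨z, hz⟩ : c.support.Nonempty := by
    rw [← Finset.card_pos, hcard]; omega
  have hcz : c z ≠ z := Perm.mem_support.1 hz
  have hτz : τ z = z := by
    rcases hdisj z with h | h
    · exact absurd h hcz
    · exact h
  have hcl : c ^ (2 * k + 1) = 1 := by
    rw [← hcard, ← hcyc.orderOf]; exact pow_orderOf_eq_one c
  have hfix : (swapPerm p q ^ (2 * k + 1)) z = z := by
    rw [hστ, hdisj.commute.mul_pow, Perm.mul_apply, Perm.pow_apply_eq_self_of_apply_eq_self hτz,
      hcl, Perm.one_apply]
  exact swapPerm_pow_odd_ne_self p q k z hfix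

/-- `σ_{1,ρ}` is the return permutation of the averaging-graph file (same map, other spelling).
[folklore] -/
theorem swapPerm_one_eq_retPerm (ρ : Perm (Fin a)) :
    swapPerm 1 ρ = (Equiv.sumComm (Fin a) (Fin a)).trans (Equiv.sumCongr ρ (Equiv.refl (Fin a))) := by
  apply Equiv.ext
  intro z
  rcases z with i | i <;> rfl

/-- The doubled permutation `σ_{1,ρ}` has as many cycles as `ρ` (fixed points counted: they become
`2`-cycles). [folklore] -/
theorem numCycles_swapPerm_one (ρ : Perm (Fin a)) : (swapPerm 1 ρ).numCycles = ρ.numCycles := by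
  rw [swapPerm_one_eq_retPerm]
  exact FermionicJetHcProjectsToCdet.numCycles_retPerm ρ

/-- THE EVEN-CYCLE CLASS FUNCTION `g_n(σ) = sgn σ · 2^{c(σ)} · [every cycle of σ is even]`
(no fixed points, all cycle lengths even) — the coefficient function of the strategist's standing
falsifier `G_n = Σ_S (−1)^{|S|} det X_S det X_{S̄}` (Cruxes/FermionicNormalForm/STRATEGY-CENSUS.md
§Negation, verified there numerically).  A proof gadget naming that family, not a route object.
[folklore] -/
def evenCycleClass (n : ℕ) (σ : Perm (Fin n)) : ℂ :=
  if (∀ i, σ i ≠ i) ∧ (∀ l ∈ σ.cycleType, Even l) then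
    ((Perm.sign σ : ℤ) : ℂ) * 2 ^ σ.numCycles else 0

/-- Conjugation is transport of structure along the conjugating permutation. [folklore] -/
theorem conj_eq_permCongr {n : ℕ} (σ τ : Perm (Fin n)) : τ * σ * τ⁻¹ = τ.permCongr σ := by
  apply Equiv.ext
  intro x
  simp [Perm.mul_apply]

/-- The even-cycle class function is a class function. [folklore] -/
theorem evenCycleClass_conj (n : ℕ) (σ τ : Perm (Fin n)) :
    evenCycleClass n (τ * σ * τ⁻¹) = evenCycleClass n σ := by
  unfold evenCycleClass
  have hfix : (∀ i, (τ * σ * τ⁻¹) i ≠ i) ↔ ∀ i, σ i ≠ i := by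
    constructor
    · intro h i hi
      apply h (τ i)
      simp [Perm.mul_apply, hi]
    · intro h i hi
      apply h (τ⁻¹ i)
      have := congrArg (τ⁻¹ : Perm (Fin n)) hi
      simpa [Perm.mul_apply] using this
  rw [Perm.cycleType_conj, conj_eq_permCongr, Perm.sign_permCongr,
    Literature.Computability.AlgebraicComplexity.DeRugyAltherre.numCycles_permCongr]
  rw [conj_eq_permCongr] at hfix
  simp only [hfix]

/-- **Doubling the even-cycle class function gives the `2`-fermionant's coefficients**:
`g_{2a}(σ_{1,ρ}) = ε · sgn ρ · 2^{c(ρ)}` (all cycles of `σ_{1,ρ}` are even, it has no fixed point,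
`c(σ_{1,ρ}) = c(ρ)`). [folklore] -/
theorem evenCycleClass_double (ρ : Perm (Fin a)) :
    evenCycleClass (a + a) (finSumFinEquiv.permCongr (swapPerm 1 ρ)) =
      ((Perm.sign (Equiv.sumComm (Fin a) (Fin a) : Perm (Fin a ⊕ Fin a)) : ℤ) : ℂ) *
        (((Perm.sign ρ : ℤ) : ℂ) * (2 : ℂ) ^ ρ.numCycles) := by
  unfold evenCycleClass
  have hfix : ∀ i, (finSumFinEquiv.permCongr (swapPerm 1 ρ)) i ≠ i := by
    intro i hi
    rw [Equiv.permCongr_apply, Equiv.apply_eq_iff_eq_symm_apply] at hi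
    exact swapPerm_ne_self 1 ρ _ hi
  have heven : ∀ l ∈ (finSumFinEquiv.permCongr (swapPerm 1 ρ)).cycleType, Even l := by
    intro l hl
    rw [cycleType_permCongr] at hl
    exact even_of_mem_cycleType_swapPerm 1 ρ hl
  rw [if_pos ⟨hfix, heven⟩, Perm.sign_permCongr, sign_swapPerm, Perm.sign_one, mul_one,
    Literature.Computability.AlgebraicComplexity.DeRugyAltherre.numCycles_permCongr,
    numCycles_swapPerm_one, Units.val_mul, Int.cast_mul]
  ring

/-- **The even-cycle family doubles to the `2`-fermionant**: substituting `(0 Y; 1 0)` into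
`G_{2a}` gives `ε · Ferm²_a(Y)`. [folklore] -/
theorem aeval_retSubstFin_one_evenCycle (a : ℕ) :
    aeval (retSubstFin (1 : Matrix (Fin a) (Fin a) ℂ)) (∑ σ : Perm (Fin (a + a)),
        C (evenCycleClass (a + a) σ) *
          ∏ i, (X (σ i, i) : MvPolynomial (Fin (a + a) × Fin (a + a)) ℂ)) =
      C (((Perm.sign (Equiv.sumComm (Fin a) (Fin a) : Perm (Fin a ⊕ Fin a)) : ℤ) : ℂ)) *
        fermionicPencil (Fin a) ℂ (2 : ℂ) := by
  rw [aeval_retSubstFin_one_gmf, fermionicPencil_eq_gmf, Finset.mul_sum]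
  refine Finset.sum_congr rfl fun ρ _ => ?_
  rw [evenCycleClass_double, map_mul, mul_assoc]

/-- `dc(Ferm²_a) ≤ dc(G_{2a}) + 1`. [folklore] -/
theorem hasDetRepr_fermionicPencil_two_of_evenCycle {m : ℕ}
    (h : HasDetRepr (∑ σ : Perm (Fin (a + a)), C (evenCycleClass (a + a) σ) *
        ∏ i, (X (σ i, i) : MvPolynomial (Fin (a + a) × Fin (a + a)) ℂ)) m) :
    HasDetRepr (fermionicPencil (Fin a) ℂ (2 : ℂ)) (m + 1) := by
  set ε : ℂ := ((Perm.sign (Equiv.sumComm (Fin a) (Fin a) : Perm (Fin a ⊕ Fin a)) : ℤ) : ℂ) with hε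
  have hε0 : ε ≠ 0 := Int.cast_ne_zero.2 (Units.ne_zero _)
  have h1 : HasDetRepr (C ε * fermionicPencil (Fin a) ℂ (2 : ℂ)) m := by
    rw [hε, ← aeval_retSubstFin_one_evenCycle a]
    exact hasDetRepr_aeval_linear h _ (totalDegree_retSubstFin_le _)
  have h2 := hasDetRepr_C_mul (HasDetRepr.mono_holds h1 (Nat.le_succ m)) ε⁻¹
  rwa [← mul_assoc, ← map_mul, inv_mul_cancel₀ hε0, map_one, one_mul] at h2

/-- **The strategist's standing falsifier is `VNP ⊄ VBP`-hard.**  If the even-cycle family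
`G_n = Σ_{σ: all cycles even} sgn σ 2^{c(σ)} X^σ` has affine determinantal representations of
p-bounded size then so does the permanent: `G_{2a}` doubles to `± Ferm²_a`
(`hasDetRepr_fermionicPencil_two_of_evenCycle`) and `Ferm²` is per-hard in `dc` currency by
de Rugy-Altherre's reduction (`not_dcPerSuperpolynomial_of_fermionicPencil_hasDetRepr`, `t = 2`).
So `G ∈` VBP slice ⟹ `VBP = VNP`; STRATEGY-CENSUS's "θ = −1 undecided" is decided.
[cite: DeRugyAltherre2013, Thm. 1 (§3)] -/
theorem not_dcPerSuperpolynomial_of_evenCycle_hasDetRepr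
    (hdc : ∃ c : ℕ, ∀ n : ℕ, ∃ m ≤ n ^ c + c,
      HasDetRepr (∑ σ : Perm (Fin n), C (evenCycleClass n σ) *
        ∏ i, (X (σ i, i) : MvPolynomial (Fin n × Fin n) ℂ)) m) :
    ¬ DcPerSuperpolynomial ℂ := by
  obtain ⟨c, hc⟩ := hdc
  refine not_dcPerSuperpolynomial_of_fermionicPencil_hasDetRepr 2 (by norm_num) (by norm_num)
    ⟨2 * c + 2 ^ c + c + 1, fun a => ?_⟩
  obtain ⟨m, hm, hrep⟩ := hc (a + a)
  refine ⟨m + 1, ?_, ?_⟩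
  · -- `m + 1 ≤ (a + a)^c + c + 1 ≤ a^(c') + 2^c + c + 1 ≤ a^(c') + c'`, `c' = 2c + 2^c + c + 1`
    have h2 : (a + a) ^ c ≤ a ^ (2 * c + 2 ^ c + c + 1) + 2 ^ c := by
      rcases Nat.lt_or_ge a 2 with ha | ha
      · interval_cases a
        · rcases Nat.eq_zero_or_pos c with rfl | hc0
          · simp
          · simp [zero_pow hc0.ne']
        · simp
      · calc (a + a) ^ c = 2 ^ c * a ^ c := by rw [← two_mul, mul_pow]
          _ ≤ a ^ c * a ^ c := Nat.mul_le_mul_right _ (Nat.pow_le_pow_left ha c)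
          _ = a ^ (2 * c) := by rw [two_mul, pow_add]
          _ ≤ a ^ (2 * c + 2 ^ c + c + 1) :=
              Nat.pow_le_pow_right (by omega) (by have := Nat.zero_le (2 ^ c); omega)
          _ ≤ a ^ (2 * c + 2 ^ c + c + 1) + 2 ^ c := Nat.le_add_right _ _
    have h4 := Nat.zero_le (2 ^ c)
    omega
  · exact_mod_cast hasDetRepr_fermionicPencil_two_of_evenCycle hrep

/-- Contrapositive, as the crux reads it: under Valiant's determinantal hypothesis the even-cycle
family is not in the VBP slice, so it cannot witness `¬ SliceVBPFermionic`. [folklore] -/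
theorem evenCycle_not_hasDetRepr_of_dcPerSuperpolynomial (h : DcPerSuperpolynomial ℂ) :
    ¬ ∃ c : ℕ, ∀ n : ℕ, ∃ m ≤ n ^ c + c,
      HasDetRepr (∑ σ : Perm (Fin n), C (evenCycleClass n σ) *
        ∏ i, (X (σ i, i) : MvPolynomial (Fin n × Fin n) ℂ)) m :=
  fun hdc => not_dcPerSuperpolynomial_of_evenCycle_hasDetRepr hdc h

end EvenCycles

end Summit.ValiantsHypothesis.ValiantsHypothesis.Theorems.TwistedDetRankSliceVBPFermionic

end
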